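import Literature.AnabelianGeometry.SemiGraphs.TemperedReconstruction
import Literature.AnabelianGeometry.SemiGraphs.BTempPointFibres
import Literature.AnabelianGeometry.SemiGraphs.TemperedCoveringsComponentsProofs
import Literature.AnabelianGeometry.SemiGraphs.TemperoidsGaloisObjectsProofs
import HarnessLib

/-!
# The covering semi-graph of anabelioids: `B^cov(G)_S ≌ B^cov(G_S)`

Mochizuki, *Semi-graphs of anabelioids*, Publ. RIMS **42** (2006) [cite: MochizukiSemiAnbd2006, §3
pp.37-39]. For an object `S` of `B^cov(G)` with covering semi-graph of anabelioids `G_S → G`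
(`CovObj.coveringGraph`, `CovObj.coveringHom` of `TemperedReconstruction`), the functor

  `CovObj.toCovering S : Over S ⥤ CovObj (S.coveringGraph)`

sending `T → S` to the family of its base-point fibres `T_{v, x_ω}` (objects of `B^temp(Stab(x_ω))`,
`Stab(x_ω) = Π_{(v,ω)}` the constituent group of `G_S`), glued along the branch-orbits by the gluings of
`T` transported by the chosen conjugators, is an equivalence of categories: faithful and full by the
fibrewise equivalences `BTempPointFibres.fibreFamily`, essentially surjective by gluing the fibrewise
preimages along the branches (`coveringEquiv`). This is the `B^cov`-level content of Proposition 3.6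
(v) ("coverings of `G_S`" = "coverings of `G` over `S`"), unconditionally; the `B^temp`-level statement
`EtaleOfTemperedCovering` is deduced in the companion files.
-/

noncomputable section

open CategoryTheory Topology

namespace Literature.AnabelianGeometry.SemiGraphs

open Literature.AlgebraicGeometry.Frobenioids.QuasiTemperoid.BTempConnected (hom_ρ hom_ext_apply
  ρ_one_apply ρ_mul_apply ρ_inv_apply)
open GaloisObjects (comp_apply iso_inv_hom_apply iso_hom_inv_apply)

universe u

namespace ProfiniteSemiGraph

namespace CovObj

variable {𝒢 : ProfiniteSemiGraph.{u}} (S : CovObj 𝒢)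

/-! ### The coincidence maps of the covering semi-graph -/

/-- If `b` abuts to `v`, the branch-orbit `(b, ω)` abuts to `(v, glueOrbit ω)`.
[cite: MochizukiSemiAnbd2006, Def 3.5(i) p.37] -/
theorem coveringAbuts_eq {b : 𝒢.graph.Branch} {v : 𝒢.graph.Vertex} (hb : 𝒢.graph.abuts b = some v)
    (ω : BTemp.Orbits (S.SE (𝒢.graph.edgeOf b))) :
    S.coveringSemiGraph.abuts ⟨b, ω⟩ = some ⟨v, S.glueOrbit b v hb ω⟩ := by
  have key : ∀ (o : Option 𝒢.graph.Vertex) (ho : 𝒢.graph.abuts b = o),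
      S.coveringAbutsAux b o ho ω = some ⟨v, S.glueOrbit b v hb ω⟩ := by
    rintro (_ | w) ho
    · exact absurd (hb.symm.trans ho) (by simp)
    · obtain rfl : w = v := Option.some.inj (ho.symm.trans hb)
      rfl
  exact key _ rfl

/-! ### Restricting objects over `S` to the constituents -/

/-- `(T → S) ↦ (T_v → S_v)`. [cite: MochizukiSemiAnbd2006, Prop 3.6(v) p.39] -/
abbrev postV (v : 𝒢.graph.Vertex) : Over S ⥤ Over (S.SV v) := Over.post (restrictV 𝒢 v)

/-- `(T → S) ↦ (T_e → S_e)`. [cite: MochizukiSemiAnbd2006, Prop 3.6(v) p.39] -/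
abbrev postE (e : 𝒢.graph.Edge) : Over S ⥤ Over (S.SE e) := Over.post (restrictE 𝒢 e)

/-- The object `b^* U → b^* S_v ≅ S_e` over `S_e` obtained from `U → S_v` by restriction along `b_*`
and the gluing of `S`. [cite: MochizukiSemiAnbd2006, Prop 3.6(v) p.39] -/
def pullOver {v : 𝒢.graph.Vertex} (U : Over (S.SV v)) (b : 𝒢.graph.Branch)
    (hb : 𝒢.graph.abuts b = some v) : Over (S.SE (𝒢.graph.edgeOf b)) :=
  Over.mk ((BTemp.res (𝒢.brHom b v hb)).map U.hom ≫ (S.glue b v hb).inv)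

/-- The structure map of `pullOver`, on points. [cite: MochizukiSemiAnbd2006, Prop 3.6(v) p.39] -/
theorem pullOver_hom_apply {v : 𝒢.graph.Vertex} (U : Over (S.SV v)) (b : 𝒢.graph.Branch)
    (hb : 𝒢.graph.abuts b = some v) (x : U.left.obj.V) :
    ((S.pullOver U b hb).hom.hom.hom x : (S.SE (𝒢.graph.edgeOf b)).obj.V) =
      (S.glue b v hb).inv.hom.hom (U.hom.hom.hom x) :=
  rfl

/-- `pullOver` on morphisms. [cite: MochizukiSemiAnbd2006, Prop 3.6(v) p.39] -/
def pullOverMap {v : 𝒢.graph.Vertex} {U U' : Over (S.SV v)} (g : U ⟶ U') (b : 𝒢.graph.Branch)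
    (hb : 𝒢.graph.abuts b = some v) : S.pullOver U b hb ⟶ S.pullOver U' b hb :=
  Over.homMk ((BTemp.res (𝒢.brHom b v hb)).map g.left) (by
    change (BTemp.res (𝒢.brHom b v hb)).map g.left ≫ (BTemp.res (𝒢.brHom b v hb)).map U'.hom ≫ _ =
      (BTemp.res (𝒢.brHom b v hb)).map U.hom ≫ _
    rw [← Category.assoc, ← Functor.map_comp, Over.w])

/-- The gluing of `T` along `b` as an isomorphism `T_e ≅ b^* T_v` OVER `S_e`.
[cite: MochizukiSemiAnbd2006, Prop 3.6(v) p.39] -/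
def glueOver (T : Over S) (b : 𝒢.graph.Branch) (v : 𝒢.graph.Vertex)
    (hb : 𝒢.graph.abuts b = some v) :
    (S.postE (𝒢.graph.edgeOf b)).obj T ≅ S.pullOver ((S.postV v).obj T) b hb :=
  Over.isoMk (T.left.glue b v hb) (by
    change (T.left.glue b v hb).hom ≫ (BTemp.res (𝒢.brHom b v hb)).map (T.hom.fV v) ≫
      (S.glue b v hb).inv = T.hom.fE (𝒢.graph.edgeOf b)
    rw [← Category.assoc, ← T.hom.comm b v hb, Category.assoc, Iso.hom_inv_id, Category.comp_id])

/-! ### Transport of base-point fibres along a branch -/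

section Transport

variable {v : 𝒢.graph.Vertex} (U : Over (S.SV v)) {b : 𝒢.graph.Branch}
  {ω : BTemp.Orbits (S.SE (𝒢.graph.edgeOf b))} {ωv : BTemp.Orbits (S.SV v)}
  (h' : S.coveringSemiGraph.abuts ⟨b, ω⟩ = some ⟨v, ωv⟩)

/-- A point of `b^* U` over the base point `x_ω ∈ S_e` is a point of `U` over `φ_b(x_ω)`; its
translate by the chosen conjugator `g_{b'}` lies over the base point `x_{ω_v}`.
[cite: MochizukiSemiAnbd2006, Prop 3.6(v) p.39] -/
theorem transport_mem (x : BTemp.PtFibre (S.pullOver U b (S.abuts_of_coveringAbuts h')) (Quot.out ω)) :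
    (U.hom.hom.hom (U.left.obj.ρ (S.conjugator h') x.1) : (S.SV v).obj.V) = Quot.out ωv := by
  have hx2 := x.2
  rw [pullOver_hom_apply] at hx2
  have hx : (U.hom.hom.hom x.1 : (S.SV v).obj.V) =
      (S.glue b v (S.abuts_of_coveringAbuts h')).hom.hom.hom (Quot.out ω) :=
    (glue_hom_inv_apply b v _ _).symm.trans
      (congrArg (fun z => ((S.glue b v (S.abuts_of_coveringAbuts h')).hom.hom.hom z : (S.SV v).obj.V)) hx2)
  rw [hom_ρ, hx]
  exact S.conjugator_spec h'

/-- The transport map `(b^* U)_{x_ω} → U_{x_{ω_v}}`, `x ↦ g_{b'} · x`.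
[cite: MochizukiSemiAnbd2006, Prop 3.6(v) p.39] -/
def transportFun (x : BTemp.PtFibre (S.pullOver U b (S.abuts_of_coveringAbuts h')) (Quot.out ω)) :
    BTemp.PtFibre U (Quot.out ωv) :=
  ⟨U.left.obj.ρ (S.conjugator h') x.1, S.transport_mem U h' x⟩

/-- The inverse transport `y ↦ g_{b'}⁻¹ · y`. [cite: MochizukiSemiAnbd2006, Prop 3.6(v) p.39] -/
theorem transport_inv_mem (y : BTemp.PtFibre U (Quot.out ωv)) :
    ((S.pullOver U b (S.abuts_of_coveringAbuts h')).hom.hom.hom (U.left.obj.ρ (S.conjugator h')⁻¹ y.1) :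
      (S.SE (𝒢.graph.edgeOf b)).obj.V) = Quot.out ω := by
  rw [pullOver_hom_apply, hom_ρ, y.2]
  have e : (S.SV v).obj.ρ (S.conjugator h')⁻¹ (Quot.out ωv) =
      (S.glue b v (S.abuts_of_coveringAbuts h')).hom.hom.hom (Quot.out ω) := by
    rw [← S.conjugator_spec h']
    exact ρ_inv_apply (S.SV v) _ _
  rw [e, glue_inv_hom_apply]

/-- The transport map is a morphism `(b^* U)_{x_ω} → (g_{b'} b_* g_{b'}⁻¹)^* U_{x_{ω_v}}` of
`B^temp(Stab(x_ω))`. [cite: MochizukiSemiAnbd2006, Prop 3.6(v) p.39] -/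
def transportHom :
    (BTemp.fibreFamily (S.SE (𝒢.graph.edgeOf b))).obj (S.pullOver U b (S.abuts_of_coveringAbuts h')) ω ⟶
      (BTemp.res (S.coveringGraph.brHom ⟨b, ω⟩ ⟨v, ωv⟩ h')).obj ((BTemp.fibreFamily (S.SV v)).obj U ωv) :=
  ObjectProperty.homMk
    { hom := TypeCat.ofHom (S.transportFun U h')
      comm := fun k => by
        apply ConcreteCategory.hom_ext
        intro x
        apply Subtype.ext
        change U.left.obj.ρ (S.conjugator h') (U.left.obj.ρ (𝒢.brHom b v _ (k : 𝒢.Ge _)) x.1) =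
          U.left.obj.ρ (S.conjugator h' * 𝒢.brHom b v _ (k : 𝒢.Ge _) * (S.conjugator h')⁻¹)
            (U.left.obj.ρ (S.conjugator h') x.1)
        rw [← ρ_mul_apply, ← ρ_mul_apply, inv_mul_cancel_right] }

/-- The transport map on points. [cite: MochizukiSemiAnbd2006, Prop 3.6(v) p.39] -/
theorem transportHom_apply
    (x : BTemp.PtFibre (S.pullOver U b (S.abuts_of_coveringAbuts h')) (Quot.out ω)) :
    ((S.transportHom U h').hom.hom x).1 = U.left.obj.ρ (S.conjugator h') x.1 :=
  rfl

/-- The transport map is bijective. [cite: MochizukiSemiAnbd2006, Prop 3.6(v) p.39] -/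
theorem transport_bijective :
    Function.Bijective fun x => (S.transportHom U h').hom.hom x := by
  refine ⟨fun x x' hxx' => ?_, fun y => ?_⟩
  · have e := congrArg Subtype.val hxx'
    change U.left.obj.ρ (S.conjugator h') x.1 = U.left.obj.ρ (S.conjugator h') x'.1 at e
    apply Subtype.ext
    have e' := congrArg (U.left.obj.ρ (S.conjugator h')⁻¹) e
    rwa [ρ_inv_apply, ρ_inv_apply] at e'
  · refine ⟨⟨U.left.obj.ρ (S.conjugator h')⁻¹ y.1, S.transport_inv_mem U h' y⟩, Subtype.ext ?_⟩
    change U.left.obj.ρ (S.conjugator h') (U.left.obj.ρ (S.conjugator h')⁻¹ y.1) = y.1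
    rw [← ρ_mul_apply, mul_inv_cancel, ρ_one_apply]

/-- **The transport isomorphism** `(b^* U)_{x_ω} ≅ (g_{b'} b_* g_{b'}⁻¹)^* U_{x_{ω_v}}`.
[cite: MochizukiSemiAnbd2006, Prop 3.6(v) p.39] -/
def transportIso :
    (BTemp.fibreFamily (S.SE (𝒢.graph.edgeOf b))).obj (S.pullOver U b (S.abuts_of_coveringAbuts h')) ω ≅
      (BTemp.res (S.coveringGraph.brHom ⟨b, ω⟩ ⟨v, ωv⟩ h')).obj ((BTemp.fibreFamily (S.SV v)).obj U ωv) :=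
  BTemp.isoOfBijective (S.transportHom U h') (S.transport_bijective U h')

/-- Naturality of the transport in `U`. [cite: MochizukiSemiAnbd2006, Prop 3.6(v) p.39] -/
theorem transportHom_naturality {U U' : Over (S.SV v)} (g : U ⟶ U') :
    (BTemp.fibreFamily (S.SE (𝒢.graph.edgeOf b))).map (S.pullOverMap g b (S.abuts_of_coveringAbuts h')) ω ≫
        S.transportHom U' h' =
      S.transportHom U h' ≫
        (BTemp.res (S.coveringGraph.brHom ⟨b, ω⟩ ⟨v, ωv⟩ h')).map ((BTemp.fibreFamily (S.SV v)).map g ωv) := by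
  apply hom_ext_apply
  intro x
  apply Subtype.ext
  exact (hom_ρ g.left (S.conjugator h') x.1).symm

end Transport

/-! ### The comparison functor `Over S ⥤ CovObj G_S` -/

/-- The gluing of the fibre family of `T → S` along the branch-orbit `(b, ω) → (v, ω_v)`: the fibre
of the gluing `T_e ≅ b^* T_v` at `x_ω` followed by the transport by `g_{b'}`.
[cite: MochizukiSemiAnbd2006, Prop 3.6(v) p.39] -/
def toCoveringGlue (T : Over S) {b : 𝒢.graph.Branch} {ω : BTemp.Orbits (S.SE (𝒢.graph.edgeOf b))}
    {v : 𝒢.graph.Vertex} {ωv : BTemp.Orbits (S.SV v)}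
    (h' : S.coveringSemiGraph.abuts ⟨b, ω⟩ = some ⟨v, ωv⟩) :
    (BTemp.fibreFamily (S.SE (𝒢.graph.edgeOf b))).obj ((S.postE (𝒢.graph.edgeOf b)).obj T) ω ≅
      (BTemp.res (S.coveringGraph.brHom ⟨b, ω⟩ ⟨v, ωv⟩ h')).obj
        ((BTemp.fibreFamily (S.SV v)).obj ((S.postV v).obj T) ωv) :=
  (BTemp.fibreFamily (S.SE (𝒢.graph.edgeOf b)) ⋙ Pi.eval _ ω).mapIso
      (S.glueOver T b v (S.abuts_of_coveringAbuts h')) ≪≫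
    S.transportIso ((S.postV v).obj T) h'

/-- The gluing on points: `t ↦ g_{b'} · glue_T(t)`. [cite: MochizukiSemiAnbd2006, Prop 3.6(v) p.39] -/
theorem toCoveringGlue_apply (T : Over S) {b : 𝒢.graph.Branch}
    {ω : BTemp.Orbits (S.SE (𝒢.graph.edgeOf b))} {v : 𝒢.graph.Vertex} {ωv : BTemp.Orbits (S.SV v)}
    (h' : S.coveringSemiGraph.abuts ⟨b, ω⟩ = some ⟨v, ωv⟩)
    (x : BTemp.PtFibre ((S.postE (𝒢.graph.edgeOf b)).obj T) (Quot.out ω)) :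
    (((S.toCoveringGlue T h').hom.hom.hom x).1 : (T.left.SV v).obj.V) =
      (T.left.SV v).obj.ρ (S.conjugator h')
        ((T.left.glue b v (S.abuts_of_coveringAbuts h')).hom.hom.hom x.1) :=
  rfl

/-- **The comparison functor** `B^cov(G)_S ⥤ B^cov(G_S)` on objects: base-point fibres glued by the
transported gluings. [cite: MochizukiSemiAnbd2006, Prop 3.6(v) p.39] -/
def toCoveringObj (T : Over S) : CovObj S.coveringGraph where
  SV v' := (BTemp.fibreFamily (S.SV v'.1)).obj ((S.postV v'.1).obj T) v'.2
  SE e' := (BTemp.fibreFamily (S.SE e'.1)).obj ((S.postE e'.1).obj T) e'.2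
  glue b' v' h' := S.toCoveringGlue T (b := b'.1) (ω := b'.2) (v := v'.1) (ωv := v'.2) h'

/-- The comparison functor on morphisms. [cite: MochizukiSemiAnbd2006, Prop 3.6(v) p.39] -/
def toCoveringMap {T T' : Over S} (f : T ⟶ T') : S.toCoveringObj T ⟶ S.toCoveringObj T' where
  fV v' := (BTemp.fibreFamily (S.SV v'.1)).map ((S.postV v'.1).map f) v'.2
  fE e' := (BTemp.fibreFamily (S.SE e'.1)).map ((S.postE e'.1).map f) e'.2
  comm b' v' h' := by
    apply hom_ext_apply
    intro x
    apply Subtype.ext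
    change (T'.left.SV v'.1).obj.ρ (S.conjugator h')
        ((T'.left.glue b'.1 v'.1 (S.abuts_of_coveringAbuts h')).hom.hom.hom
          ((f.left.fE (𝒢.graph.edgeOf b'.1)).hom.hom x.1)) =
      (f.left.fV v'.1).hom.hom ((T.left.SV v'.1).obj.ρ (S.conjugator h')
        ((T.left.glue b'.1 v'.1 (S.abuts_of_coveringAbuts h')).hom.hom.hom x.1))
    rw [glue_hom_apply, hom_ρ]

/-- **The comparison functor** `CovObj.toCovering S : B^cov(G)_S ⥤ B^cov(G_S)`.
[cite: MochizukiSemiAnbd2006, Prop 3.6(v) p.39] -/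
def toCovering : Over S ⥤ CovObj S.coveringGraph where
  obj T := S.toCoveringObj T
  map f := S.toCoveringMap f
  map_id T := by
    refine CovHom.ext ?_ ?_ <;> funext c <;> apply hom_ext_apply <;> intro x <;> rfl
  map_comp f g := by
    refine CovHom.ext ?_ ?_ <;> funext c <;> apply hom_ext_apply <;> intro x <;> rfl

/-- The comparison functor on morphisms, vertex components, on points. [cite: MochizukiSemiAnbd2006, Prop 3.6(v) p.39] -/
theorem toCovering_map_fV_apply {T T' : Over S} (f : T ⟶ T') (v' : S.coveringGraph.graph.Vertex)
    (x : BTemp.PtFibre ((S.postV v'.1).obj T) (Quot.out v'.2)) :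
    (((S.toCovering.map f).fV v').hom.hom x).1 = (f.left.fV v'.1).hom.hom x.1 :=
  rfl

/-- The comparison functor on morphisms, edge components, on points. [cite: MochizukiSemiAnbd2006, Prop 3.6(v) p.39] -/
theorem toCovering_map_fE_apply {T T' : Over S} (f : T ⟶ T') (e' : S.coveringGraph.graph.Edge)
    (x : BTemp.PtFibre ((S.postE e'.1).obj T) (Quot.out e'.2)) :
    (((S.toCovering.map f).fE e').hom.hom x).1 = (f.left.fE e'.1).hom.hom x.1 :=
  rfl

/-! ### `toCovering` is faithful and full -/

/-- `toCovering S` is faithful. [cite: MochizukiSemiAnbd2006, Prop 3.6(v) p.39] -/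
instance toCovering_faithful : S.toCovering.Faithful :=
  ⟨fun {T T'} {f f'} h => by
    apply Over.OverMorphism.ext
    refine CovHom.ext ?_ ?_ <;> funext c
    · have hv : (BTemp.fibreFamily (S.SV c)).map ((S.postV c).map f) =
          (BTemp.fibreFamily (S.SV c)).map ((S.postV c).map f') := by
        funext ω
        exact congrArg (fun k : S.toCoveringObj T ⟶ S.toCoveringObj T' => k.fV ⟨c, ω⟩) h
      exact congrArg (fun k : (S.postV c).obj T ⟶ (S.postV c).obj T' => k.left)
        ((BTemp.fibreFamily (S.SV c)).map_injective hv)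
    · have he : (BTemp.fibreFamily (S.SE c)).map ((S.postE c).map f) =
          (BTemp.fibreFamily (S.SE c)).map ((S.postE c).map f') := by
        funext ω
        exact congrArg (fun k : S.toCoveringObj T ⟶ S.toCoveringObj T' => k.fE ⟨c, ω⟩) h
      exact congrArg (fun k : (S.postE c).obj T ⟶ (S.postE c).obj T' => k.left)
        ((BTemp.fibreFamily (S.SE c)).map_injective he)⟩

section Full

variable {T T' : Over S} (φ : S.toCovering.obj T ⟶ S.toCovering.obj T')

/-- The vertex components of a preimage: glue the given maps of base-point fibres over `S_v`.
[cite: MochizukiSemiAnbd2006, Prop 3.6(v) p.39] -/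
def liftV (v : 𝒢.graph.Vertex) : (S.postV v).obj T ⟶ (S.postV v).obj T' :=
  (BTemp.fibreFamily (S.SV v)).preimage fun ω => φ.fV ⟨v, ω⟩

/-- The edge components of a preimage. [cite: MochizukiSemiAnbd2006, Prop 3.6(v) p.39] -/
def liftE (e : 𝒢.graph.Edge) : (S.postE e).obj T ⟶ (S.postE e).obj T' :=
  (BTemp.fibreFamily (S.SE e)).preimage fun ω => φ.fE ⟨e, ω⟩

/-- On base-point fibres the vertex lift is the given map. [cite: MochizukiSemiAnbd2006, Prop 3.6(v) p.39] -/
theorem liftV_apply (v : 𝒢.graph.Vertex) (ω : BTemp.Orbits (S.SV v))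
    (x : BTemp.PtFibre ((S.postV v).obj T) (Quot.out ω)) :
    ((S.liftV φ v).left.hom.hom x.1 : (T'.left.SV v).obj.V) = ((φ.fV ⟨v, ω⟩).hom.hom x).1 := by
  have e := (BTemp.fibreFamily (S.SV v)).map_preimage (X := (S.postV v).obj T)
    (Y := (S.postV v).obj T') (fun ω => φ.fV ⟨v, ω⟩)
  exact congrArg (fun k : (BTemp.fibreFamily (S.SV v)).obj ((S.postV v).obj T) ⟶
      (BTemp.fibreFamily (S.SV v)).obj ((S.postV v).obj T') => ((k ω).hom.hom x).1) e

/-- On base-point fibres the edge lift is the given map. [cite: MochizukiSemiAnbd2006, Prop 3.6(v) p.39] -/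
theorem liftE_apply (e : 𝒢.graph.Edge) (ω : BTemp.Orbits (S.SE e))
    (x : BTemp.PtFibre ((S.postE e).obj T) (Quot.out ω)) :
    ((S.liftE φ e).left.hom.hom x.1 : (T'.left.SE e).obj.V) = ((φ.fE ⟨e, ω⟩).hom.hom x).1 := by
  have h := (BTemp.fibreFamily (S.SE e)).map_preimage (X := (S.postE e).obj T)
    (Y := (S.postE e).obj T') (fun ω => φ.fE ⟨e, ω⟩)
  exact congrArg (fun k : (BTemp.fibreFamily (S.SE e)).obj ((S.postE e).obj T) ⟶
      (BTemp.fibreFamily (S.SE e)).obj ((S.postE e).obj T') => ((k ω).hom.hom x).1) h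

/-- The lifts are compatible with the gluings ON BASE-POINT FIBRES (this is the compatibility of `φ`
with the gluings of `G_S`, untransported). [cite: MochizukiSemiAnbd2006, Prop 3.6(v) p.39] -/
theorem lift_comm_base {b : 𝒢.graph.Branch} {ω : BTemp.Orbits (S.SE (𝒢.graph.edgeOf b))}
    {v : 𝒢.graph.Vertex} {ωv : BTemp.Orbits (S.SV v)}
    (h' : S.coveringSemiGraph.abuts ⟨b, ω⟩ = some ⟨v, ωv⟩)
    (x : BTemp.PtFibre ((S.postE (𝒢.graph.edgeOf b)).obj T) (Quot.out ω)) :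
    ((T'.left.glue b v (S.abuts_of_coveringAbuts h')).hom.hom.hom
        ((S.liftE φ (𝒢.graph.edgeOf b)).left.hom.hom x.1) : (T'.left.SV v).obj.V) =
      (S.liftV φ v).left.hom.hom ((T.left.glue b v (S.abuts_of_coveringAbuts h')).hom.hom.hom x.1) := by
  -- the point `g_{b'} · glue_T(x)` of the base-point fibre of `ω_v`
  let y : BTemp.PtFibre ((S.postV v).obj T) (Quot.out ωv) := (S.toCoveringGlue T h').hom.hom.hom x
  have hE := S.liftE_apply φ (𝒢.graph.edgeOf b) ω x
  have hV := S.liftV_apply φ v ωv y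
  -- `φ` commutes with the transported gluings at the branch-orbit `(b, ω)`
  have hc : (T'.left.SV v).obj.ρ (S.conjugator h')
      ((T'.left.glue b v (S.abuts_of_coveringAbuts h')).hom.hom.hom
        ((φ.fE ⟨𝒢.graph.edgeOf b, ω⟩).hom.hom x).1) = ((φ.fV ⟨v, ωv⟩).hom.hom y).1 :=
    congrArg (fun k : (S.toCovering.obj T).SE ⟨𝒢.graph.edgeOf b, ω⟩ ⟶
      (BTemp.res (S.coveringGraph.brHom ⟨b, ω⟩ ⟨v, ωv⟩ h')).obj ((S.toCovering.obj T').SV ⟨v, ωv⟩) =>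
        ((k.hom.hom x).1 : (T'.left.SV v).obj.V)) (φ.comm ⟨b, ω⟩ ⟨v, ωv⟩ h')
  have hρ : ((S.liftV φ v).left.hom.hom ((T.left.SV v).obj.ρ (S.conjugator h')
      ((T.left.glue b v (S.abuts_of_coveringAbuts h')).hom.hom.hom x.1)) : (T'.left.SV v).obj.V) =
      (T'.left.SV v).obj.ρ (S.conjugator h')
        ((S.liftV φ v).left.hom.hom ((T.left.glue b v (S.abuts_of_coveringAbuts h')).hom.hom.hom x.1)) :=
    hom_ρ _ _ _
  -- cancel the conjugator
  have key : (T'.left.SV v).obj.ρ (S.conjugator h')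
      ((T'.left.glue b v (S.abuts_of_coveringAbuts h')).hom.hom.hom
        ((S.liftE φ (𝒢.graph.edgeOf b)).left.hom.hom x.1)) =
      (T'.left.SV v).obj.ρ (S.conjugator h')
        ((S.liftV φ v).left.hom.hom ((T.left.glue b v (S.abuts_of_coveringAbuts h')).hom.hom.hom x.1)) := by
    rw [hE, hc, ← hV, ← hρ]
    rfl
  have key' := congrArg ((T'.left.SV v).obj.ρ (S.conjugator h')⁻¹) key
  rwa [ρ_inv_apply, ρ_inv_apply] at key'

/-- The lifts are compatible with the gluings. [cite: MochizukiSemiAnbd2006, Prop 3.6(v) p.39] -/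
theorem lift_comm (b : 𝒢.graph.Branch) (v : 𝒢.graph.Vertex) (hb : 𝒢.graph.abuts b = some v) :
    (S.liftE φ (𝒢.graph.edgeOf b)).left ≫ (T'.left.glue b v hb).hom =
      (T.left.glue b v hb).hom ≫ (BTemp.res (𝒢.brHom b v hb)).map (S.liftV φ v).left := by
  apply hom_ext_apply
  intro t
  -- translate `t` into the base-point fibre of its orbit
  let s : (S.SE (𝒢.graph.edgeOf b)).obj.V := (T.hom.fE (𝒢.graph.edgeOf b)).hom.hom t
  let γ : 𝒢.Ge (𝒢.graph.edgeOf b) := BTemp.sec (S.SE (𝒢.graph.edgeOf b)) s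
  let x := BTemp.toBaseFibre ((S.postE (𝒢.graph.edgeOf b)).obj T) t
  have ht : (T.left.SE (𝒢.graph.edgeOf b)).obj.ρ γ x.1 = t := by
    change (T.left.SE _).obj.ρ γ ((T.left.SE _).obj.ρ γ⁻¹ t) = t
    rw [← ρ_mul_apply, mul_inv_cancel, ρ_one_apply]
  have h' := S.coveringAbuts_eq hb (BTemp.cl (S.SE (𝒢.graph.edgeOf b)) s)
  -- equivariance of the four maps involved
  have hρE : ∀ z, ((S.liftE φ (𝒢.graph.edgeOf b)).left.hom.hom ((T.left.SE _).obj.ρ γ z) :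
      (T'.left.SE (𝒢.graph.edgeOf b)).obj.V) = (T'.left.SE _).obj.ρ γ ((S.liftE φ _).left.hom.hom z) :=
    fun z => hom_ρ _ _ _
  have hρV : ∀ z, ((S.liftV φ v).left.hom.hom ((T.left.SV v).obj.ρ (𝒢.brHom b v hb γ) z) :
      (T'.left.SV v).obj.V) = (T'.left.SV v).obj.ρ (𝒢.brHom b v hb γ) ((S.liftV φ v).left.hom.hom z) :=
    fun z => hom_ρ _ _ _
  have hgl : ∀ z, ((T.left.glue b v hb).hom.hom.hom ((T.left.SE _).obj.ρ γ z) : (T.left.SV v).obj.V) =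
      (T.left.SV v).obj.ρ (𝒢.brHom b v hb γ) ((T.left.glue b v hb).hom.hom.hom z) :=
    fun z => hom_ρ _ _ _
  have hgl' : ∀ z, ((T'.left.glue b v hb).hom.hom.hom ((T'.left.SE _).obj.ρ γ z) : (T'.left.SV v).obj.V) =
      (T'.left.SV v).obj.ρ (𝒢.brHom b v hb γ) ((T'.left.glue b v hb).hom.hom.hom z) :=
    fun z => hom_ρ _ _ _
  change ((T'.left.glue b v hb).hom.hom.hom ((S.liftE φ (𝒢.graph.edgeOf b)).left.hom.hom t) :
      (T'.left.SV v).obj.V) = (S.liftV φ v).left.hom.hom ((T.left.glue b v hb).hom.hom.hom t)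
  rw [← ht, hρE, hgl', S.lift_comm_base φ h' x, ← hρV, ← hgl]

/-- The preimage of `φ` under `toCovering S`. [cite: MochizukiSemiAnbd2006, Prop 3.6(v) p.39] -/
def lift : T ⟶ T' :=
  Over.homMk
    { fV := fun v => (S.liftV φ v).left
      fE := fun e => (S.liftE φ e).left
      comm := fun b v hb => S.lift_comm φ b v hb }
    (by
      refine CovHom.ext ?_ ?_ <;> funext c
      · exact Over.w (S.liftV φ c)
      · exact Over.w (S.liftE φ c))

/-- `toCovering S` maps the lift back to `φ`. [cite: MochizukiSemiAnbd2006, Prop 3.6(v) p.39] -/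
theorem toCovering_map_lift : S.toCovering.map (S.lift φ) = φ := by
  refine CovHom.ext ?_ ?_ <;> funext c <;> apply hom_ext_apply <;> intro x <;> apply Subtype.ext
  · exact S.liftV_apply φ c.1 c.2 x
  · exact S.liftE_apply φ c.1 c.2 x

end Full

/-- `toCovering S` is full. [cite: MochizukiSemiAnbd2006, Prop 3.6(v) p.39] -/
instance toCovering_full : S.toCovering.Full :=
  ⟨fun φ => ⟨S.lift φ, S.toCovering_map_lift φ⟩⟩

/-! ### `toCovering` is essentially surjective -/

section EssSurj

variable (T' : CovObj S.coveringGraph)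

/-- The vertex object `T_v → S_v` with prescribed base-point fibres `(T'_{(v,ω)})_ω`.
[cite: MochizukiSemiAnbd2006, Prop 3.6(v) p.39] -/
def preV (v : 𝒢.graph.Vertex) : Over (S.SV v) :=
  (BTemp.fibreFamily (S.SV v)).objPreimage fun ω => T'.SV ⟨v, ω⟩

/-- The edge object `T_e → S_e` with prescribed base-point fibres. [cite: MochizukiSemiAnbd2006, Prop 3.6(v) p.39] -/
def preE (e : 𝒢.graph.Edge) : Over (S.SE e) :=
  (BTemp.fibreFamily (S.SE e)).objPreimage fun ω => T'.SE ⟨e, ω⟩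

/-- `(T_v)_{x_ω} ≅ T'_{(v,ω)}`. [cite: MochizukiSemiAnbd2006, Prop 3.6(v) p.39] -/
def preVIso (v : 𝒢.graph.Vertex) :
    (BTemp.fibreFamily (S.SV v)).obj (S.preV T' v) ≅ fun ω => T'.SV ⟨v, ω⟩ :=
  (BTemp.fibreFamily (S.SV v)).objObjPreimageIso fun ω => T'.SV ⟨v, ω⟩

/-- `(T_e)_{x_ω} ≅ T'_{(e,ω)}`. [cite: MochizukiSemiAnbd2006, Prop 3.6(v) p.39] -/
def preEIso (e : 𝒢.graph.Edge) :
    (BTemp.fibreFamily (S.SE e)).obj (S.preE T' e) ≅ fun ω => T'.SE ⟨e, ω⟩ :=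
  (BTemp.fibreFamily (S.SE e)).objObjPreimageIso fun ω => T'.SE ⟨e, ω⟩

/-- The fibrewise gluing data of the preimage along `b`: at the base point `x_ω` of `S_e`,
`(T_e)_{x_ω} ≅ T'_{(e,ω)} ≅ (g b_* g⁻¹)^* T'_{(v,ω_v)} ≅ (g b_* g⁻¹)^* (T_v)_{x_{ω_v}} ≅ (b^* T_v)_{x_ω}`.
[cite: MochizukiSemiAnbd2006, Prop 3.6(v) p.39] -/
def preGlueFibre (b : 𝒢.graph.Branch) (v : 𝒢.graph.Vertex) (hb : 𝒢.graph.abuts b = some v)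
    (ω : BTemp.Orbits (S.SE (𝒢.graph.edgeOf b))) :
    (BTemp.fibreFamily (S.SE (𝒢.graph.edgeOf b))).obj (S.preE T' (𝒢.graph.edgeOf b)) ω ≅
      (BTemp.fibreFamily (S.SE (𝒢.graph.edgeOf b))).obj (S.pullOver (S.preV T' v) b hb) ω :=
  Pi.isoApp (S.preEIso T' (𝒢.graph.edgeOf b)) ω ≪≫
    T'.glue ⟨b, ω⟩ ⟨v, S.glueOrbit b v hb ω⟩ (S.coveringAbuts_eq hb ω) ≪≫
    (BTemp.res (S.coveringGraph.brHom ⟨b, ω⟩ ⟨v, S.glueOrbit b v hb ω⟩ (S.coveringAbuts_eq hb ω))).mapIso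
      (Pi.isoApp (S.preVIso T' v) (S.glueOrbit b v hb ω)).symm ≪≫
    (S.transportIso (S.preV T' v) (S.coveringAbuts_eq hb ω)).symm

/-- The fibrewise gluing data, solved for the gluing of `T'`. [cite: MochizukiSemiAnbd2006, Prop 3.6(v) p.39] -/
theorem preGlueFibre_hom_comp (b : 𝒢.graph.Branch) (v : 𝒢.graph.Vertex) (hb : 𝒢.graph.abuts b = some v)
    (ω : BTemp.Orbits (S.SE (𝒢.graph.edgeOf b))) :
    (S.preGlueFibre T' b v hb ω).hom ≫ (S.transportIso (S.preV T' v) (S.coveringAbuts_eq hb ω)).hom ≫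
        (BTemp.res (S.coveringGraph.brHom ⟨b, ω⟩ ⟨v, _⟩ (S.coveringAbuts_eq hb ω))).map
          (Pi.isoApp (S.preVIso T' v) (S.glueOrbit b v hb ω)).hom =
      (Pi.isoApp (S.preEIso T' (𝒢.graph.edgeOf b)) ω).hom ≫
        (T'.glue ⟨b, ω⟩ ⟨v, S.glueOrbit b v hb ω⟩ (S.coveringAbuts_eq hb ω)).hom := by
  have h2 : (BTemp.res (S.coveringGraph.brHom ⟨b, ω⟩ ⟨v, _⟩ (S.coveringAbuts_eq hb ω))).map
        (Pi.isoApp (S.preVIso T' v) (S.glueOrbit b v hb ω)).inv ≫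
      (BTemp.res (S.coveringGraph.brHom ⟨b, ω⟩ ⟨v, _⟩ (S.coveringAbuts_eq hb ω))).map
        (Pi.isoApp (S.preVIso T' v) (S.glueOrbit b v hb ω)).hom = 𝟙 _ :=
    ((BTemp.res _).mapIso (Pi.isoApp (S.preVIso T' v) (S.glueOrbit b v hb ω))).inv_hom_id
  unfold preGlueFibre
  rw [Iso.trans_hom, Iso.trans_hom, Iso.trans_hom, Iso.symm_hom, Functor.mapIso_hom, Iso.symm_hom,
    Category.assoc, Category.assoc, Category.assoc, Iso.inv_hom_id_assoc, h2, Category.comp_id]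

/-- The gluing of the preimage along `b` as an isomorphism over `S_e`, lifted from the fibrewise data.
[cite: MochizukiSemiAnbd2006, Prop 3.6(v) p.39] -/
def preGlueOver (b : 𝒢.graph.Branch) (v : 𝒢.graph.Vertex) (hb : 𝒢.graph.abuts b = some v) :
    S.preE T' (𝒢.graph.edgeOf b) ≅ S.pullOver (S.preV T' v) b hb :=
  (BTemp.fibreFamily (S.SE (𝒢.graph.edgeOf b))).preimageIso
    { hom := fun ω => (S.preGlueFibre T' b v hb ω).hom
      inv := fun ω => (S.preGlueFibre T' b v hb ω).inv
      hom_inv_id := by funext ω; exact (S.preGlueFibre T' b v hb ω).hom_inv_id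
      inv_hom_id := by funext ω; exact (S.preGlueFibre T' b v hb ω).inv_hom_id }

/-- **The preimage** of `T' ∈ B^cov(G_S)`, as an object of `B^cov(G)`: fibrewise preimages glued along
the branches. [cite: MochizukiSemiAnbd2006, Prop 3.6(v) p.39] -/
def preObj : CovObj 𝒢 where
  SV v := (S.preV T' v).left
  SE e := (S.preE T' e).left
  glue b v hb := (Over.forget _).mapIso (S.preGlueOver T' b v hb)

/-- The structure map `preObj T' ⟶ S`. [cite: MochizukiSemiAnbd2006, Prop 3.6(v) p.39] -/
def preHom : S.preObj T' ⟶ S where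
  fV v := (S.preV T' v).hom
  fE e := (S.preE T' e).hom
  comm b v hb := by
    change (S.preE T' _).hom ≫ (S.glue b v hb).hom =
      (S.preGlueOver T' b v hb).hom.left ≫ (BTemp.res (𝒢.brHom b v hb)).map (S.preV T' v).hom
    rw [← Over.w (S.preGlueOver T' b v hb).hom]
    change ((S.preGlueOver T' b v hb).hom.left ≫ (BTemp.res (𝒢.brHom b v hb)).map (S.preV T' v).hom ≫
      (S.glue b v hb).inv) ≫ (S.glue b v hb).hom = _
    simp only [Category.assoc, Iso.inv_hom_id, Category.comp_id]

/-- **The preimage** `T → S` of `T' ∈ B^cov(G_S)`. [cite: MochizukiSemiAnbd2006, Prop 3.6(v) p.39] -/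
def pre : Over S :=
  Over.mk (S.preHom T')

/-- The restriction of the preimage to `v` IS the fibrewise preimage. [cite: MochizukiSemiAnbd2006, Prop 3.6(v) p.39] -/
theorem postV_pre (v : 𝒢.graph.Vertex) : (S.postV v).obj (S.pre T') = S.preV T' v := rfl

/-- The restriction of the preimage to `e` IS the fibrewise preimage. [cite: MochizukiSemiAnbd2006, Prop 3.6(v) p.39] -/
theorem postE_pre (e : 𝒢.graph.Edge) : (S.postE e).obj (S.pre T') = S.preE T' e := rfl

/-- The gluing of the preimage, restricted over `S_e`, is the lifted fibrewise gluing.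
[cite: MochizukiSemiAnbd2006, Prop 3.6(v) p.39] -/
theorem glueOver_pre_hom (b : 𝒢.graph.Branch) (v : 𝒢.graph.Vertex) (hb : 𝒢.graph.abuts b = some v) :
    (S.glueOver (S.pre T') b v hb).hom = (S.preGlueOver T' b v hb).hom :=
  Over.OverMorphism.ext rfl

/-- The fibres of the gluing of the preimage are the prescribed fibrewise gluing data.
[cite: MochizukiSemiAnbd2006, Prop 3.6(v) p.39] -/
theorem fibre_glueOver_pre (b : 𝒢.graph.Branch) (v : 𝒢.graph.Vertex) (hb : 𝒢.graph.abuts b = some v)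
    (ω : BTemp.Orbits (S.SE (𝒢.graph.edgeOf b))) :
    (BTemp.fibreFamily (S.SE (𝒢.graph.edgeOf b))).map (S.glueOver (S.pre T') b v hb).hom ω =
      (S.preGlueFibre T' b v hb ω).hom := by
  rw [glueOver_pre_hom]
  exact congrFun ((BTemp.fibreFamily (S.SE (𝒢.graph.edgeOf b))).map_preimage _) ω

/-- The comparison `toCovering (pre T') ≅ T'`, vertex components. [cite: MochizukiSemiAnbd2006, Prop 3.6(v) p.39] -/
def preIsoV (v' : S.coveringGraph.graph.Vertex) : (S.toCovering.obj (S.pre T')).SV v' ≅ T'.SV v' :=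
  Pi.isoApp (S.preVIso T' v'.1) v'.2

/-- The comparison `toCovering (pre T') ≅ T'`, edge components. [cite: MochizukiSemiAnbd2006, Prop 3.6(v) p.39] -/
def preIsoE (e' : S.coveringGraph.graph.Edge) : (S.toCovering.obj (S.pre T')).SE e' ≅ T'.SE e' :=
  Pi.isoApp (S.preEIso T' e'.1) e'.2

/-- Compatibility of the comparison with the gluings. [cite: MochizukiSemiAnbd2006, Prop 3.6(v) p.39] -/
theorem preIso_comm (b' : S.coveringGraph.graph.Branch) (v' : S.coveringGraph.graph.Vertex)
    (h' : S.coveringGraph.graph.abuts b' = some v') :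
    (S.preIsoE T' (S.coveringGraph.graph.edgeOf b')).hom ≫ (T'.glue b' v' h').hom =
      ((S.toCovering.obj (S.pre T')).glue b' v' h').hom ≫
        (BTemp.res (S.coveringGraph.brHom b' v' h')).map (S.preIsoV T' v').hom := by
  obtain ⟨b, ω⟩ := b'
  obtain ⟨v, ωv⟩ := v'
  have hb := S.abuts_of_coveringAbuts h'
  obtain rfl : S.glueOrbit b v hb ω = ωv := S.glueOrbit_eq_of_coveringAbuts h'
  obtain rfl : h' = S.coveringAbuts_eq hb ω := rfl
  -- the transported gluing of `pre T'` at `(b, ω)`, via `fibre_glueOver_pre`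
  change (Pi.isoApp (S.preEIso T' (𝒢.graph.edgeOf b)) ω).hom ≫
      (T'.glue ⟨b, ω⟩ ⟨v, _⟩ (S.coveringAbuts_eq hb ω)).hom =
    ((BTemp.fibreFamily (S.SE (𝒢.graph.edgeOf b))).map (S.glueOver (S.pre T') b v hb).hom ω ≫
        (S.transportIso (S.preV T' v) (S.coveringAbuts_eq hb ω)).hom) ≫
      (BTemp.res (S.coveringGraph.brHom ⟨b, ω⟩ ⟨v, _⟩ (S.coveringAbuts_eq hb ω))).map
        (Pi.isoApp (S.preVIso T' v) (S.glueOrbit b v hb ω)).hom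
  have hX := S.fibre_glueOver_pre T' b v hb ω
  have key := S.preGlueFibre_hom_comp T' b v hb ω
  exact ((Category.assoc _ _ _).trans
    ((congrArg (fun Y : (BTemp.fibreFamily (S.SE (𝒢.graph.edgeOf b))).obj (S.preE T' _) ω ⟶
        (BTemp.fibreFamily (S.SE (𝒢.graph.edgeOf b))).obj (S.pullOver (S.preV T' v) b hb) ω =>
        Y ≫ (S.transportIso (S.preV T' v) (S.coveringAbuts_eq hb ω)).hom ≫
          (BTemp.res (S.coveringGraph.brHom ⟨b, ω⟩ ⟨v, _⟩ (S.coveringAbuts_eq hb ω))).map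
            (Pi.isoApp (S.preVIso T' v) (S.glueOrbit b v hb ω)).hom) hX).trans key)).symm

/-- **The comparison isomorphism** `toCovering (pre T') ≅ T'`. [cite: MochizukiSemiAnbd2006, Prop 3.6(v) p.39] -/
def preIso : S.toCovering.obj (S.pre T') ≅ T' where
  hom := { fV := fun v' => (S.preIsoV T' v').hom
           fE := fun e' => (S.preIsoE T' e').hom
           comm := fun b' v' h' => S.preIso_comm T' b' v' h' }
  inv := { fV := fun v' => (S.preIsoV T' v').inv
           fE := fun e' => (S.preIsoE T' e').inv
           comm := fun b' v' h' => by
             rw [Iso.inv_comp_eq, ← Category.assoc, S.preIso_comm T' b' v' h', Category.assoc,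
               ← (BTemp.res _).map_comp, Iso.hom_inv_id, CategoryTheory.Functor.map_id,
               Category.comp_id] }
  hom_inv_id := by
    refine CovHom.ext ?_ ?_ <;> funext c
    · exact (S.preIsoV T' c).hom_inv_id
    · exact (S.preIsoE T' c).hom_inv_id
  inv_hom_id := by
    refine CovHom.ext ?_ ?_ <;> funext c
    · exact (S.preIsoV T' c).inv_hom_id
    · exact (S.preIsoE T' c).inv_hom_id

end EssSurj

/-- `toCovering S` is essentially surjective. [cite: MochizukiSemiAnbd2006, Prop 3.6(v) p.39] -/
instance toCovering_essSurj : S.toCovering.EssSurj :=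
  ⟨fun T' => ⟨S.pre T', ⟨S.preIso T'⟩⟩⟩

/-- `toCovering S` is an equivalence. [cite: MochizukiSemiAnbd2006, Prop 3.6(v) p.39] -/
instance toCovering_isEquivalence : S.toCovering.IsEquivalence := { }

/-- **`B^cov(G)_S ≌ B^cov(G_S)`**: objects of `B^cov(G)` over `S` "are" objects of `B^cov` of the
covering semi-graph of anabelioids `G_S → G` ([SemiAnbd] §3 p. 37, Def. 3.5 (i); the `B^cov`-level
content of Prop. 3.6 (v)). [cite: MochizukiSemiAnbd2006, Prop 3.6(v) p.39] -/
def coveringEquiv : Over S ≌ CovObj S.coveringGraph :=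
  S.toCovering.asEquivalence

end CovObj

end ProfiniteSemiGraph

end Literature.AnabelianGeometry.SemiGraphs

end
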